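import Literature.NumberTheory.EllipticCurves.GoodReductionUnramifiedProofs
import Literature.NumberTheory.EllipticCurves.KernelReductionOrdinaryTorsionProofs
import HarnessLib

/-!
# Inertia moves every point into the kernel of reduction; at a place of good ordinary reduction
# above `ℓ`, `(τ - 1) E[ℓᵐ]` has at most `ℓᵐ` elements for `τ` inertial
# (Serre 1968, IV, A.2.2; Silverman AEC VII.2–3)

`Proofs` file (theorems only, no definitions, no named facts), topic `NumberTheory/EllipticCurves`;
sequel of `KernelReductionOrdinaryTorsionProofs` and of `GoodReductionUnramifiedProofs`.

Serre, *Abelian ℓ-adic representations and elliptic curves* (1968), Ch. IV, Appendix A.2.2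
treats an elliptic curve with good reduction of height `1` (ordinary) at a place `v` of residue
characteristic `ℓ`: the Tate module of the formal group `X = T_ℓ(Ê) ⊂ T_ℓ(E)` has rank `1`, is
stable under the decomposition group, and the inertia group acts trivially on `T_ℓ(E)/X`
(everything reduces into `Ẽ(k̄)`, on which inertia acts trivially: Silverman, *AEC*, VII.2.1).
At finite level this says: **for `τ` in the inertia group, `P ↦ P^τ - P` maps `E[ℓᵐ]` into the
kernel of reduction, onto a subgroup of order `≤ ℓᵐ`.**  This file proves exactly that, for an
elliptic curve over a number field `K` and the global inertia group `I_𝔓 ≤ Γ_K` of a prime `𝔓`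
of `\bar ℤ_K` above `v`:

* `Literature.NumberTheory.EllipticCurves.one_lt_valuation_of_map_sub_eq_some` — the valued-field
  statement (setting of `GoodReductionInertia`: `(L, w)`, a `w`-integral equation with `w Δ = 1`,
  `σ` an isometry with `w (σ z - z) < 1` on `w`-integers): `P^σ - P`, if affine, has
  `x`-coordinate of valuation `> 1` (Silverman VII.2.1; proof by the two cases of the group law
  already in the tree, `add_eq_zero_or_one_lt_val`, `val_addX_le_one_of_one_lt`);
* `WeierstrassCurve.exists_map_smul_sub_reducesToZero` — the number-field instance: for a good
  model `M/𝓞_v` of `E` at `v` (`C • E_{K_v} = M_{K_v}`, `Δ(M)` a unit) and `τ ∈ I_𝔓`, an injective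
  additive `Ψ : E(K̄) → M(K̄_v)` (an embedding `K̄ → K̄_v` cutting out `𝔓`, Neukirch II (9.6) via
  `exists_mem_inertia_apply_eq_holds`, then the change of variables, as in
  `smul_localPoints_eq_of_mem_inertia_holds`) carrying every `P^τ - P` into the kernel of
  reduction of `M_{K̄_v}` for the spectral valuation;
* `WeierstrassCurve.card_map_smul_sub_geomTorsion_le_pow` — **if moreover `v ∣ ℓ` (`ℓ` odd) and the
  good model is ordinary (`A_ℓ(M) ∈ 𝓞_vˣ`, `WeierstrassCurve.hasseCoeff`), then
  `#((τ - 1) E[ℓᵐ]) ≤ ℓᵐ` for every `τ ∈ I_𝔓` and every `m`** (by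
  `card_addSubgroup_le_pow_of_hasseCoeff` of `KernelReductionOrdinaryTorsionProofs`).

The last statement is the local input at `ℓ` for the ordinary case of Serre's theorem that the
`ℓ`-adic image of a non-CM curve is not abelian (1968, IV.2.2): an element of inertia at an
ordinary `v ∣ ℓ` acting non-trivially on `V_ℓ E` has a fixed line.

## References

* [SerreAbelianLadic1968] J.-P. Serre, *Abelian ℓ-adic representations and elliptic curves*
  (1968), Ch. IV, A.2.2; IV.2.2.
* [SilvermanAEC2009] J. H. Silverman, *The Arithmetic of Elliptic Curves*, 2nd ed. (2009),
  Prop. VII.2.1, VII.§3, VIII.§1, X.§4.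
* [NeukirchANT1999] J. Neukirch, *Algebraic Number Theory* (1999), Ch. II §9 Prop. (9.6).

## Design

No definitions; `noncomputable section`; conventions (`geomPoints`, `absIntegers`, `primesAbove`,
`Ideal.inertia`, spectral valuation produced existentially) exactly as in
`GoodReductionUnramifiedProofs` / `SelmerFiniteProofs`; the good ordinary model enters through
explicit data `(C, M)` with `IsUnit M.Δ`, `IsUnit (M.hasseCoeff ℓ)`; the endomorphism `τ - 1` of
`E(K̄)` is `DistribSMul.toAddMonoidHom _ τ - AddMonoidHom.id _`.
-/

noncomputable section

open scoped Classical NNReal Valued Pointwise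
open NumberField IsDedekindDomain Polynomial

universe u

/-! ## The valued-field statement: `P^σ - P ∈ E₁ ∪ {O}` for `σ` in the inertia group -/

namespace Literature.NumberTheory.EllipticCurves

-- `_root_`: the import closure declares `Literature.NumberTheory.EllipticCurves.WeierstrassCurve.*`
open _root_.WeierstrassCurve

variable {L : Type u} [Field L] {w : Valuation L ℝ≥0}

/-- **Inertia moves every point into the kernel of reduction** (Silverman, *AEC*, VII.2 with
Prop. VII.2.1: `\widetilde{P^σ - P} = P̃^σ - P̃ = Õ` since inertia acts trivially on the reduced
curve).  On a `w`-integral Weierstrass equation with `w Δ = 1` over a valued field `(L, w)`, for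
an automorphism `σ` preserving `w` with `w (σ z - z) < 1` whenever `w z ≤ 1` and any point `P`,
the point `P^σ - P`, if affine, has `x`-coordinate of valuation `> 1`, i.e. lies in `E₁`.  Proof
without the reduction homomorphism, along the lines of the tree's
`map_eq_of_inertia_of_zsmul_sub_eq_zero`: for `P` integral, `P^σ + (-P)` is a sum of integral
points with opposite reductions (`add_eq_zero_or_one_lt_val`); for `P ∈ E₁`, an integral
`T = P^σ - P` would make `P^σ = P + T` integral (`val_addX_le_one_of_one_lt`).
[cite: SilvermanAEC2009, Prop. VII.2.1] -/
theorem one_lt_valuation_of_map_sub_eq_some {F : Type*} [Field F] [Algebra F L]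
    (W : WeierstrassCurve F) [(W.baseChange L).IsIntegral w.integer] (hΔ : w (W.baseChange L).Δ = 1)
    (σ : L ≃ₐ[F] L) (hσ : ∀ z, w (σ z) = w z) (hσI : ∀ z, w z ≤ 1 → w (σ z - z) < 1)
    (P : (W.baseChange L).toAffine.Point) {s t : L} {hst : (W.baseChange L).toAffine.Nonsingular s t}
    (hT : Affine.Point.map (σ : L →ₐ[F] L) P - P = .some s t hst) : 1 < w s := by
  rcases P with _ | ⟨x, y, hxy⟩
  · exfalso
    rw [← Affine.Point.zero_def, map_zero, sub_zero] at hT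
    exact Affine.Point.some_ne_zero _ hT.symm
  set σ' : L →ₐ[F] L := (σ : L →ₐ[F] L)
  have hσ₁ : ∀ z, w (σ' z) = w z := hσ
  have hσ₂ : ∀ z, w z ≤ 1 → w (σ' z - z) < 1 := hσI
  obtain ⟨hxy', hmap⟩ : ∃ h', Affine.Point.map σ' (.some x y hxy) = .some (σ' x) (σ' y) h' :=
    ⟨_, Affine.Point.map_some σ' hxy⟩
  rw [hmap] at hT
  by_contra hs
  rw [not_lt] at hs
  have ht : w t ≤ 1 := val_y_le_one hst.1 hs
  by_cases hx : w x ≤ 1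
  · -- `P` integral: `T = P^σ + (-P)` is a sum of integral points with opposite reductions
    have hy : w y ≤ 1 := val_y_le_one hxy.1 hx
    have hT' : Affine.Point.some (σ' x) (σ' y) hxy' +
        .some x ((W.baseChange L).toAffine.negY x y) ((Affine.nonsingular_neg ..).mpr hxy) =
          .some s t hst := by
      rw [← hT, sub_eq_add_neg, Affine.Point.neg_some]
    rcases add_eq_zero_or_one_lt_val hΔ (h₁ := hxy') (h₂ := (Affine.nonsingular_neg ..).mpr hxy)
        (by rw [hσ₁]; exact hx) hx (hσ₂ x hx) (by rw [Affine.negY_negY]; exact hσ₂ y hy) with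
      h0 | ⟨x₃, y₃, h₃, h3eq, hlt⟩
    · rw [hT'] at h0
      exact Affine.Point.some_ne_zero _ h0
    · rw [hT', Affine.Point.some.injEq] at h3eq
      rw [h3eq.1] at hs
      exact absurd hs (not_le.mpr hlt)
  · -- `P` in the kernel of reduction: then `P^σ = P + T` would have integral `x`-coordinate
    rw [not_le] at hx
    obtain ⟨hxs, hle⟩ := val_addX_le_one_of_one_lt hxy.1 hx hs ht
    have hsum : Affine.Point.some (σ' x) (σ' y) hxy' = .some x y hxy + .some s t hst := by
      rw [← hT, add_sub_cancel]
    rw [Affine.Point.add_of_X_ne hxs, Affine.Point.some.injEq] at hsum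
    have hle' : w (σ' x) ≤ 1 := hsum.1 ▸ hle
    rw [hσ₁] at hle'
    exact absurd hle' (not_le.mpr hx)

end Literature.NumberTheory.EllipticCurves

/-! ## Number fields: the spectral valuation of `ℓ` at a place above `ℓ` -/

namespace IsDedekindDomain.HeightOneSpectrum

open Literature.NumberTheory.EllipticCurves Literature.NumberTheory.GaloisRepresentations Field

variable {K : Type u} [Field K] [NumberField K] {v : HeightOneSpectrum (𝓞 K)}
  {w : Valuation (AlgebraicClosure (v.adicCompletion K)) ℝ≥0}
  (hw : ∀ x, (w x : ℝ) = spectralNorm (v.adicCompletion K) (AlgebraicClosure (v.adicCompletion K)) x)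
include hw

/-- At a place `v ∣ ℓ`, `|ℓ|_v < 1` in `K̄_v` (cf. `spectralValuation_algebraMap_ringOfIntegers_lt_one`
of `UnramifiedLayerRootsProofs`, not imported here). [folklore] -/
theorem spectralValuation_natCast_lt_one {ℓ : ℕ} (hℓ : (ℓ : 𝓞 K) ∈ v.asIdeal) :
    w (ℓ : AlgebraicClosure (v.adicCompletion K)) < 1 := by
  rw [← map_natCast (algebraMap (𝓞 K) (AlgebraicClosure (v.adicCompletion K))) ℓ,
    ← NNReal.coe_lt_coe, algebraMap_ringOfIntegers_algClosure_apply,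
    coe_spectralValuation_algebraMap hw, NNReal.coe_one, Valued.toNormedField.norm_lt_one_iff,
    valuedAdicCompletion_eq_valuation']
  exact (v.valuation_lt_one_iff_mem _).mpr hℓ

end IsDedekindDomain.HeightOneSpectrum

/-! ## Number fields: `(τ - 1) E[ℓᵐ]` at a place of good ordinary reduction above `ℓ` -/

namespace WeierstrassCurve

open Literature.NumberTheory.EllipticCurves Literature.NumberTheory.GaloisRepresentations Field
  IsDedekindDomain.HeightOneSpectrum

variable {K : Type u} [Field K] [NumberField K] (W : WeierstrassCurve K)

/-- **Inertia moves geometric points into the kernel of reduction, transported to a good local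
model.**  Let `E/K` be an elliptic curve over a number field, `v` a finite place, `M` a
Weierstrass equation over `𝓞_v` with unit discriminant and `C` a change of variables over `K_v`
with `C • E_{K_v} = M_{K_v}` (a good model at `v`), `𝔓` a prime of `\bar ℤ_K` above `v` and
`τ ∈ I_𝔓 ≤ Γ_K`.  Then there are: the spectral valuation `w` of `K̄_v`, an injective additive map
`Ψ : E(K̄) → M(K̄_v)` (an embedding `K̄ → K̄_v` cutting out `𝔓` followed by the change of variables),
such that `M_{K̄_v}` is `w`-integral and, for every `P ∈ E(K̄)`, the point `Ψ (P^τ - P)`, if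
affine, has `x`-coordinate of valuation `> 1` — "`P^τ - P` reduces to `Õ` at `v`" (Silverman AEC
VII.2.1: inertia acts trivially on the reduced curve).  Glue as in
`smul_geomPoints_eq_of_mem_inertia` (Neukirch II (9.6), `exists_mem_inertia_apply_eq_holds`).
[cite: SilvermanAEC2009, Prop. VII.2.1] [cite: NeukirchANT1999, Ch. II §9 Prop. (9.6)] -/
theorem exists_map_smul_sub_reducesToZero [W.IsElliptic] {v : HeightOneSpectrum (𝓞 K)}
    {C : VariableChange (v.adicCompletion K)} {M : WeierstrassCurve (v.adicCompletionIntegers K)}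
    (hCM : C • W.baseChange (v.adicCompletion K) =
      M.map (algebraMap (v.adicCompletionIntegers K) (v.adicCompletion K))) (hΔ : IsUnit M.Δ)
    {𝔓 : Ideal (absIntegers (𝓞 K) K)} (h𝔓 : 𝔓 ∈ v.primesAbove)
    {τ : absoluteGaloisGroup K} (hτ : τ ∈ 𝔓.inertia (absoluteGaloisGroup K)) :
    ∃ (w : Valuation (AlgebraicClosure (v.adicCompletion K)) ℝ≥0)
      (_ : ∀ x, (w x : ℝ) =
        spectralNorm (v.adicCompletion K) (AlgebraicClosure (v.adicCompletion K)) x)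
      (_ : ((M.map (algebraMap (v.adicCompletionIntegers K) (v.adicCompletion K))).baseChange
        (AlgebraicClosure (v.adicCompletion K))).IsIntegral w.integer)
      (Ψ : geomPoints W →+ ((M.map (algebraMap (v.adicCompletionIntegers K)
        (v.adicCompletion K))).baseChange (AlgebraicClosure (v.adicCompletion K))).toAffine.Point),
      Function.Injective Ψ ∧
        ∀ (P : geomPoints W) (s t : AlgebraicClosure (v.adicCompletion K)) h,
          Ψ (τ • P - P) = .some s t h → 1 < w s := by
  obtain ⟨𝔐, h𝔐⟩ := v.localPrimesAbove_nonempty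
  -- arrange `𝔓 = 𝔓_{ι,𝔐}` for an embedding `ι : K̄ → K̄_v`
  obtain ⟨g, hg⟩ := HeightOneSpectrum.exists_smul_eq_of_mem_primesAbove_holds
    (HeightOneSpectrum.primeBelow_mem_primesAbove
      (ι := closureEmb (K := K) (v.adicCompletion K)) h𝔐) h𝔓
  set ι : AlgebraicClosure K →ₐ[K] AlgebraicClosure (v.adicCompletion K) :=
    (closureEmb (K := K) (v.adicCompletion K)).comp
      ((show AlgebraicClosure K ≃ₐ[K] AlgebraicClosure K from g⁻¹) :
        AlgebraicClosure K →ₐ[K] AlgebraicClosure K) with hι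
  have h1 : 𝔓 = v.primeBelow ι 𝔐 := by
    rw [hι, HeightOneSpectrum.primeBelow_comp, ← hg]
    exact congrArg (· • _) (inv_inv g).symm
  rw [h1] at hτ
  -- lift `τ` to the local inertia group `I_𝔐 ≤ Γ_{K_v}` (Neukirch II (9.6))
  obtain ⟨σ, hσI, hσ⟩ :=
    IsDedekindDomain.HeightOneSpectrum.exists_mem_inertia_apply_eq_holds v ι h𝔐 hτ
  have hres : resGalOfEmb ι σ = τ := resGalOfEmb_eq_of_apply_eq ι hσ
  obtain ⟨w, hw⟩ := v.exists_spectralValuation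
  -- notation: `E = K_v`, `L = K̄_v`, `σE = σ` as a `K_v`-automorphism of `L`
  set E := v.adicCompletion K
  set L := AlgebraicClosure (v.adicCompletion K)
  set σE : L ≃ₐ[E] L := absoluteGaloisGroup.toAlgEquiv _ σ with hσE
  have hσ₁ : ∀ z : L, w (σE z) = w z := fun z ↦ spectralValuation_smul hw σ z
  have hσ₂ : ∀ z : L, w z ≤ 1 → w (σE z - z) < 1 := (mem_inertia_iff_spectralValuation hw h𝔐).mp hσI
  haveI hint := isIntegral_spectralValuation_baseChange hw M
  -- transport to the good model, equivariantly (as in `smul_localPoints_eq_of_mem_inertia_holds`)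
  have hCM' := congrArg (fun X : WeierstrassCurve E ↦ X.baseChange L) hCM
  let Φ : localPoints W E ≃+
      ((M.map (algebraMap (v.adicCompletionIntegers K) E)).baseChange L).toAffine.Point :=
    ((Affine.Point.congrEquiv (baseChange_baseChange_adicCompletion W v).symm).trans
      (VariableChange.pointEquivBaseChange (W.baseChange E) C L)).trans
      (Affine.Point.congrEquiv hCM')
  have hΦ : ∀ Q : localPoints W E, Φ (σ • Q) = Affine.Point.map (σE : L →ₐ[E] L) (Φ Q) := by
    intro Q
    change Affine.Point.congrEquiv hCM' (VariableChange.pointEquivBaseChange (W.baseChange E) C L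
        (Affine.Point.congrEquiv (baseChange_baseChange_adicCompletion W v).symm (σ • Q))) =
      Affine.Point.map (σE : L →ₐ[E] L) (Affine.Point.congrEquiv hCM'
        (VariableChange.pointEquivBaseChange (W.baseChange E) C L
          (Affine.Point.congrEquiv (baseChange_baseChange_adicCompletion W v).symm Q)))
    rw [congrEquiv_smul, VariableChange.pointEquivBaseChange_map_algEquiv, hσE]
    exact Affine.Point.congrEquiv_baseChange_map hCM _ _
  refine ⟨w, hw, hint, Φ.toAddMonoidHom.comp (pointsMapOfEmb W ι),
    Φ.injective.comp (pointsMapOfEmb_injective W ι), fun P s t h hP ↦ ?_⟩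
  have hequiv : pointsMapOfEmb W ι (τ • P) = σ • pointsMapOfEmb W ι P := by
    rw [← hres]
    exact pointsMapOfEmb_smul W ι σ P
  have hΔw := spectralValuation_Δ_baseChange hw hΔ
  rw [AddMonoidHom.coe_comp, Function.comp_apply, map_sub, hequiv, AddEquiv.coe_toAddMonoidHom,
    map_sub, hΦ] at hP
  exact one_lt_valuation_of_map_sub_eq_some (w := w) _ hΔw σE hσ₁ hσ₂ _ hP

/-- **At a place of good ordinary reduction above `ℓ`, `(τ - 1) E[ℓᵐ]` has at most `ℓᵐ` elements
for every `τ` in the inertia group** (Serre, *Abelian ℓ-adic representations* (1968), IV,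
A.2.2: for a curve with good reduction of height `1` at `v ∣ ℓ` the inertia group acts trivially
on `T_ℓ(E)/T_ℓ(Ê)`, and `T_ℓ(Ê)` has rank `1`).  Hypotheses: `E/K` elliptic over a number field,
`ℓ` an odd prime, `v ∣ ℓ` a finite place with a good model `M` over `𝓞_v` (`C • E_{K_v} = M_{K_v}`,
`Δ(M) ∈ 𝓞_vˣ`) which is **ordinary**: its Hasse invariant `A_ℓ(M)` (`WeierstrassCurve.hasseCoeff`,
Silverman AEC V.4.1(a)) is a unit of `𝓞_v`; `𝔓 ∣ v` a prime of `\bar ℤ_K`, `τ ∈ I_𝔓 ≤ Γ_K`.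
Conclusion: the image of `E[ℓᵐ] = E(K̄)[ℓᵐ]` under `P ↦ P^τ - P` has at most `ℓᵐ` elements.
Proof: that image, transported to `M(K̄_v)` (`exists_map_smul_sub_reducesToZero`), is a finite
subgroup of the kernel of reduction killed by `ℓᵐ`, and such subgroups have order `≤ ℓᵐ` at an
ordinary place (`card_addSubgroup_le_pow_of_hasseCoeff`, `KernelReductionOrdinaryTorsionProofs`).
[cite: SerreAbelianLadic1968, IV A.2.2] -/
theorem card_map_smul_sub_geomTorsion_le_pow [W.IsElliptic] {v : HeightOneSpectrum (𝓞 K)}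
    {ℓ : ℕ} [hℓ : Fact ℓ.Prime] (hℓ2 : ℓ ≠ 2) (hℓv : (ℓ : 𝓞 K) ∈ v.asIdeal)
    {C : VariableChange (v.adicCompletion K)} {M : WeierstrassCurve (v.adicCompletionIntegers K)}
    (hCM : C • W.baseChange (v.adicCompletion K) =
      M.map (algebraMap (v.adicCompletionIntegers K) (v.adicCompletion K))) (hΔ : IsUnit M.Δ)
    (hA : IsUnit (M.hasseCoeff ℓ))
    {𝔓 : Ideal (absIntegers (𝓞 K) K)} (h𝔓 : 𝔓 ∈ v.primesAbove)
    {τ : absoluteGaloisGroup K} (hτ : τ ∈ 𝔓.inertia (absoluteGaloisGroup K)) (m : ℕ) :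
    Nat.card ((geomTorsion W ((ℓ ^ m : ℕ) : ℤ)).map
      (DistribSMul.toAddMonoidHom (geomPoints W) τ - AddMonoidHom.id (geomPoints W))) ≤
        ℓ ^ m := by
  obtain ⟨w, hw, hint, Ψ, hΨinj, hΨ⟩ := W.exists_map_smul_sub_reducesToZero hCM hΔ h𝔓 hτ
  haveI := hint
  set f : geomPoints W →+ geomPoints W :=
    DistribSMul.toAddMonoidHom (geomPoints W) τ - AddMonoidHom.id (geomPoints W) with hf
  have hfapply : ∀ P, f P = τ • P - P := fun P ↦ rfl
  set H := (geomTorsion W ((ℓ ^ m : ℕ) : ℤ)).map f with hH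
  -- finiteness
  have hℓm0 : ((ℓ ^ m : ℕ) : ℤ) ≠ 0 := by exact_mod_cast pow_ne_zero m hℓ.out.ne_zero
  haveI : Finite (geomTorsion W ((ℓ ^ m : ℕ) : ℤ)) :=
    finite_torsionPoints_holds W (AlgebraicClosure K) hℓm0
  have hHfin : (H : Set (geomPoints W)).Finite := by
    rw [hH, AddSubgroup.coe_map]
    exact (Set.toFinite _).image f
  haveI : Finite H := hHfin.to_subtype
  set G := H.map Ψ with hG
  have hGfin : (G : Set ((M.map (algebraMap (v.adicCompletionIntegers K)
      (v.adicCompletion K))).baseChange (AlgebraicClosure (v.adicCompletion K))).toAffine.Point).Finite := by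
    rw [hG, AddSubgroup.coe_map]
    exact hHfin.image Ψ
  haveI : Finite G := hGfin.to_subtype
  have hcard : Nat.card H = Nat.card G := Nat.card_congr (H.equivMapOfInjective Ψ hΨinj).toEquiv
  rw [hcard]
  have hℓL : (ℓ : AlgebraicClosure (v.adicCompletion K)) ≠ 0 := by
    rw [← map_natCast (algebraMap K (AlgebraicClosure (v.adicCompletion K))) ℓ]
    exact (map_ne_zero_iff _ (algebraMap K _).injective).mpr (Nat.cast_ne_zero.mpr hℓ.out.ne_zero)
  have hAw : w (((M.map (algebraMap (v.adicCompletionIntegers K) (v.adicCompletion K))).baseChange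
      (AlgebraicClosure (v.adicCompletion K))).hasseCoeff ℓ) = 1 := by
    rw [baseChange, map_hasseCoeff, map_hasseCoeff]
    exact spectralValuation_eq_one_of_isUnit hw hA
  refine card_addSubgroup_le_pow_of_hasseCoeff w _ hℓ2 (spectralValuation_natCast_lt_one hw hℓv)
    hℓL hAw m G ?_ ?_
  · -- the affine points of `G` lie in `E₁`
    intro x y h hmem
    obtain ⟨Q, hQ, hQeq⟩ := AddSubgroup.mem_map.mp hmem
    obtain ⟨P, -, rfl⟩ := AddSubgroup.mem_map.mp hQ
    exact hΨ P x y h hQeq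
  · -- `G` is killed by `ℓᵐ`
    intro Q hmem
    obtain ⟨Q', hQ', rfl⟩ := AddSubgroup.mem_map.mp hmem
    obtain ⟨P, hP, rfl⟩ := AddSubgroup.mem_map.mp hQ'
    have hP0 : ((ℓ ^ m : ℕ) : ℤ) • P = 0 := (Submodule.mem_torsionBy_iff _ P).mp hP
    rw [← map_zsmul Ψ, ← map_zsmul f, hP0, map_zero, map_zero]

end WeierstrassCurve

end
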